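import Mathlib
import Summits.Ventures.CertifiedManyBodySolver.Theorems.M3PrimeEdgeSplitLowerEdge_ge_m4o5WardWindowSound
import HarnessLib

/-!
# The slack reader of the `LowerEdge_ge_m4o5` skeleton of record: `stub_slackAbsorb` DISCHARGED

HONEST FRAMING: first certified bounds; not a superconductivity verdict. NO number and no crux/summit statement is
proved here. This file lands stub 2 `stub_slackAbsorb : WardD4WindowSound → WardSlackWindowBound` of the registered
crux-plan skeleton `Cruxes/LowerEdge_ge_m4o5/Lines/fo_dual_rounding.lean` (sha 94f99bf03038, pen hub-lb-dual-plan-2;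
item stmt-Ventures-21721): a Ward × `D₄` window certificate whose Gram multiplier is a block family `Z k` that is only
NEARLY PSD (`Z k + δ_k•1 ⪰ 0`, certified `λ_min` floors) still certifies, at the a-priori price `Σ_k δ_k Σ_i (r k i)²`
when every generator ships with an SOS norm bound `(r k i)²•1 − (O k i)ᴴ(O k i) ⪰ 0` (Jansson–Chaykin–Keil Lemma 3.1
in the window algebra). PROOF = hub-lb-sym-ref-1's kernel-checked evidence file `pub/hub-lb/hub-lb-sym-ref-1/slack/
SlackAbsorb.lean` (sha16 8686c191df574d56; co-read PASS by hub-lb-dual-ref-2; a second lineage exists in dual-plan-1's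
`Lines/dualreplay.lean`), transplanted VERBATIM onto the tree copies of the statement texts: `WardD4Identity` /
`WardD4WindowSound` are the ones landed in `Theorems.WardSlot` (p612283, verbatim = skeleton §1), `WardSlackWindowBound`
below is the verbatim copy of skeleton l.128–156. Landed by hub-lb-sym-eng-3 (team lb-sym lander); credit for the proof:
hub-lb-sym-ref-1. After this, the skeleton of record retains ONE stub: the VALUE statement `stub_nearCert_m4o5`
(no certificate ≥ −4/5 exists today). A certified bound is a number with a certificate; nothing here predicts
superconductivity.
-/

namespace Summit.Ventures.CertifiedManyBodySolver.Theorems.WardSlot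

open Matrix Finset
open Literature.MathematicalPhysics.QuantumLattice
open Literature.MathematicalPhysics.QuantumLattice.HubbardWave0
open Literature.MathematicalPhysics.QuantumLattice.ThermodynamicLimit
open Literature.Probability.LatticeModels
open Literature.MathematicalPhysics.QuantumManyBody.StateRelaxation
open scoped ComplexOrder BigOperators MatrixOrder

/-- **VERBATIM COPY of the registered `FoDualRounding.WardSlackWindowBound`** (skeleton of record §1, l.128–156; same
text in the −83/100 twin): the SLACK READER statement — `WardD4Identity` with Gram multiplier `blockDiagonal' Z`,
`Z k + δ_k • 1 ⪰ 0`, `0 ≤ δ_k`, generators with SOS norm bounds `r k i`; conclusion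
`c − Σₖ ‖aₖ‖ − Σ_k δ_k Σ_i (r k i)² ≤ energyDensityTT' t t' U n`. (Copied because Cruxes workfiles are not importable;
the gate's stub check matches name + signature text.) -/
def WardSlackWindowBound : Prop :=
  ∀ (t t' U : ℝ), 0 ≤ U → ∀ (n : ℝ), 0 ≤ n → n < 2 →
  ∀ (Λ Λ' : Finset (Site 2)) (hΛ : Λ ⊆ Λ') (_h8 : thicken Λ 1 ⊆ Λ')
    (h0 : thicken ({0} : Finset (Site 2)) 1 ⊆ Λ') (hz : (0 : Site 2) ∈ Λ')
    (μ : ℝ)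
    (β : Type) (_ : Fintype β) (_ : DecidableEq β) (mb : β → Type) (_ : ∀ k, Fintype (mb k))
    (_ : ∀ k, DecidableEq (mb k))
    (Z : (k : β) → Matrix (mb k) (mb k) ℂ) (δs : β → ℝ) (_hδ : ∀ k, 0 ≤ δs k)
    (_hZ : ∀ k, (Z k + ((δs k : ℝ) : ℂ) • (1 : Matrix (mb k) (mb k) ℂ)).PosSemidef)
    (O : (k : β) → mb k → FermionOp Λ') (r : (k : β) → mb k → ℝ)
    (_hO : ∀ k i, ((((r k i) ^ 2 : ℝ) : ℂ) • (1 : FermionOp Λ') - (O k i)ᴴ * O k i).PosSemidef)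
    (κ : Type) (s : Finset κ) (B : κ → FermionOp Λ)
    (ι : Type) (tt : Finset ι) (γ : ι → DihedralGroup 4) (wv : ι → Site 2)
    (hsh : ∀ l, d4ShiftSet (γ l) (wv l) Λ ⊆ Λ') (Y : ι → FermionOp Λ)
    (ρ : Type) (u : Finset ρ) (b : ρ → ℂ) (cw : ρ → List (Orb (PolySite Λ') × Bool))
    (_hcw : ∀ j ∈ u, ladderCharge (cw j) ≠ 0 ∨ ladderSpinCharge (cw j) ≠ 0)
    (θ : Type) (wp : Finset θ) (Xp : θ → FermionOp Λ')
    (θ' : Type) (wm : Finset θ') (Xm : θ' → FermionOp Λ')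
    (δ : Type) (ah : Finset δ) (dc : δ → ℝ) (V : δ → FermionOp Λ')
    (κ'' : Type) (w : Finset κ'') (a : κ'' → ℂ) (word : κ'' → List (Orb (PolySite Λ') × Bool))
    (c : ℝ),
    WardD4Identity t t' U n hΛ h0 hz μ (Matrix.blockDiagonal' Z) (fun p : (k : β) × mb k => O p.1 p.2)
      s B tt γ wv hsh Y u b cw wp Xp wm Xm ah dc V w a word c →
    c - ∑ k ∈ w, ‖a k‖ - ∑ k, δs k * ∑ i, (r k i) ^ 2 ≤ energyDensityTT' t t' U n

/-! ## Matrix / `gramForm` lemmas (hub-lb-sym-ref-1) -/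

/-- `fromBlocks A 0 0 D ⪰ 0` when `A ⪰ 0` and `D ⪰ 0` (no Schur complement needed). [folklore] -/
theorem posSemidef_fromBlocks_diag {m n : Type*} [Fintype m] [Fintype n]
    {A : Matrix m m ℂ} {D : Matrix n n ℂ} (hA : A.PosSemidef) (hD : D.PosSemidef) :
    (Matrix.fromBlocks A 0 0 D).PosSemidef := by
  refine .of_dotProduct_mulVec_nonneg (hA.1.fromBlocks (by simp) hD.1) fun x => ?_
  have key : star x ⬝ᵥ (Matrix.fromBlocks A 0 0 D *ᵥ x) =
      star (x ∘ Sum.inl) ⬝ᵥ (A *ᵥ (x ∘ Sum.inl)) + star (x ∘ Sum.inr) ⬝ᵥ (D *ᵥ (x ∘ Sum.inr)) := by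
    rw [Matrix.fromBlocks_mulVec]
    simp [dotProduct, Fintype.sum_sum_type]
  rw [key]
  exact add_nonneg (hA.dotProduct_mulVec_nonneg _) (hD.dotProduct_mulVec_nonneg _)

/-- A block-diagonal matrix of PSD blocks is PSD. [folklore] -/
theorem posSemidef_blockDiagonal' {β : Type*} [Fintype β] [DecidableEq β] {mb : β → Type*}
    [∀ k, Fintype (mb k)] {Z : (k : β) → Matrix (mb k) (mb k) ℂ} (hZ : ∀ k, (Z k).PosSemidef) :
    (Matrix.blockDiagonal' Z).PosSemidef := by
  refine .of_dotProduct_mulVec_nonneg ?_ fun x => ?_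
  · show (Matrix.blockDiagonal' Z)ᴴ = Matrix.blockDiagonal' Z
    rw [Matrix.blockDiagonal'_conjTranspose]
    congr 1
    funext k
    exact (hZ k).1
  · have key : star x ⬝ᵥ (Matrix.blockDiagonal' Z *ᵥ x) =
        ∑ k, star (fun i => x ⟨k, i⟩) ⬝ᵥ (Z k *ᵥ fun i => x ⟨k, i⟩) := by
      simp only [dotProduct, Matrix.mulVec, Pi.star_apply]
      rw [Fintype.sum_sigma]
      refine Finset.sum_congr rfl fun k _ => Finset.sum_congr rfl fun i _ => ?_
      congr 1
      rw [Fintype.sum_sigma, Finset.sum_eq_single k]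
      · simp [Matrix.blockDiagonal'_apply_eq]
      · intro k' _ hk'
        simp [Matrix.blockDiagonal'_apply_ne _ _ _ (Ne.symm hk')]
      · simp
    rw [key]
    exact Finset.sum_nonneg fun k _ => (hZ k).dotProduct_mulVec_nonneg _

section Gram

variable {𝓐 : Type*} [Ring 𝓐] [StarRing 𝓐] [Algebra ℂ 𝓐]

/-- `gramForm` of a block-diagonal multiplier on a `Sum`-indexed generator family splits. [folklore] -/
theorem gramForm_fromBlocks_diag {m n : Type*} [Fintype m] [Fintype n] (A : Matrix m m ℂ)
    (D : Matrix n n ℂ) (O : m → 𝓐) (F : n → 𝓐) :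
    gramForm (Matrix.fromBlocks A 0 0 D) (Sum.elim O F) = gramForm A O + gramForm D F := by
  simp [gramForm, Fintype.sum_sum_type]

/-- `gramForm` of a diagonal multiplier. [folklore] -/
theorem gramForm_diagonal {m : Type*} [Fintype m] [DecidableEq m] (d : m → ℂ) (O : m → 𝓐) :
    gramForm (Matrix.diagonal d) O = ∑ i, d i • (star (O i) * O i) := by
  unfold gramForm
  refine Finset.sum_congr rfl fun i _ => ?_
  rw [Finset.sum_eq_single i]
  · simp
  · intro j _ hji
    simp [Matrix.diagonal_apply_ne _ (Ne.symm hji)]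
  · simp

end Gram

/-! ## The stub -/

/-- **Stub 2 of the skeleton of record, DISCHARGED — slack absorption `WardD4WindowSound → WardSlackWindowBound`**
(Jansson–Chaykin–Keil Lemma 3.1 in the window algebra: square roots `CFC.sqrt` of the SOS defects, exact reader fed
with generators `Sum.elim O F` on `σ ⊕ σ`, PSD multiplier `fromBlocks (blockDiagonal' (Z k + δ_k•1)) 0 0 (diagonal δ)`,
constant `c − Σ_k δ_k Σ_i r²`). Proof: hub-lb-sym-ref-1 (`SlackAbsorb.lean` 8686c191df574d56), verbatim.
[cite: JanssonChaykinKeil2008, Lemma 3.1] -/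
theorem stub_slackAbsorb : WardD4WindowSound → WardSlackWindowBound := by
  intro hS t t' U hU n hn0 hn2 Λ Λ' hΛ h8 h0 hz μ β _ _ mb _ _ Z δs hδ hZ O r hO κ s B ι tt γ wv hsh Y ρ u b
    cw hcw θ wp Xp θ' wm Xm δ ah dc V κ'' w a word c hId
  classical
  -- the SOS defects and their square roots
  set P : (Σ k : β, mb k) → FermionOp Λ' :=
    fun p => ((((r p.1 p.2) ^ 2 : ℝ) : ℂ) • (1 : FermionOp Λ') - (O p.1 p.2)ᴴ * O p.1 p.2) with hPdef
  have hP : ∀ p, (P p).PosSemidef := fun p => hO p.1 p.2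
  obtain ⟨F, hF⟩ : ∃ F : (Σ k : β, mb k) → FermionOp Λ', ∀ p, star (F p) * F p = P p := by
    refine ⟨fun p => CFC.sqrt (P p), fun p => ?_⟩
    have hnn : (0 : FermionOp Λ') ≤ P p := (hP p).nonneg
    rw [(IsSelfAdjoint.of_nonneg (CFC.sqrt_nonneg (P p))).star_eq, CFC.sqrt_mul_sqrt_self (P p) hnn]
  -- the slack price and the diagonal weights
  obtain ⟨S, hSdef⟩ : ∃ S : ℝ, S = ∑ k, δs k * ∑ i, (r k i) ^ 2 := ⟨_, rfl⟩
  set d : (Σ k : β, mb k) → ℂ := fun p => ((δs p.1 : ℝ) : ℂ) with hddef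
  have hd : 0 ≤ d := fun p => Complex.zero_le_real.mpr (hδ p.1)
  -- the new multiplier and generators
  obtain ⟨Λm', hΛm'⟩ : ∃ M : Matrix ((Σ k : β, mb k) ⊕ (Σ k : β, mb k))
      ((Σ k : β, mb k) ⊕ (Σ k : β, mb k)) ℂ,
      M = Matrix.fromBlocks (Matrix.blockDiagonal' fun k => Z k + ((δs k : ℝ) : ℂ) • (1 : Matrix (mb k) (mb k) ℂ))
        0 0 (Matrix.diagonal d) := ⟨_, rfl⟩
  obtain ⟨O', hO'⟩ : ∃ G : (Σ k : β, mb k) ⊕ (Σ k : β, mb k) → FermionOp Λ',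
      G = Sum.elim (fun p => O p.1 p.2) F := ⟨_, rfl⟩
  have hPSD : Λm'.PosSemidef := by
    rw [hΛm']
    exact posSemidef_fromBlocks_diag (posSemidef_blockDiagonal' hZ) (Matrix.PosSemidef.diagonal hd)
  -- the Gram identity: gramForm Λm' O' = gramForm (blockDiagonal' Z) O + S • 1
  have hbd : (Matrix.blockDiagonal' fun k => Z k + ((δs k : ℝ) : ℂ) • (1 : Matrix (mb k) (mb k) ℂ)) =
      Matrix.blockDiagonal' Z + Matrix.diagonal d := by
    have : (fun k => Z k + ((δs k : ℝ) : ℂ) • (1 : Matrix (mb k) (mb k) ℂ)) =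
        Z + fun k => Matrix.diagonal fun _ : mb k => ((δs k : ℝ) : ℂ) := by
      funext k
      simp [Matrix.smul_one_eq_diagonal]
    rw [this, Matrix.blockDiagonal'_add, Matrix.blockDiagonal'_diagonal]
  have hSum : (∑ p : (Σ k : β, mb k), d p * (((r p.1 p.2) ^ 2 : ℝ) : ℂ)) = ((S : ℝ) : ℂ) := by
    rw [hSdef]
    push_cast
    rw [Fintype.sum_sigma]
    simp [hddef, Finset.mul_sum]
  have hgram : gramForm Λm' O' =
      gramForm (Matrix.blockDiagonal' Z) (fun p : (k : β) × mb k => O p.1 p.2) + ((S : ℝ) : ℂ) • (1 : FermionOp Λ') := by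
    rw [hΛm', hO', gramForm_fromBlocks_diag, hbd, gramForm_add, gramForm_diagonal, gramForm_diagonal, add_assoc,
      ← Finset.sum_add_distrib]
    congr 1
    rw [← hSum, Finset.sum_smul]
    refine Finset.sum_congr rfl fun p _ => ?_
    rw [← smul_add, hF p, hPdef]
    simp only [Matrix.star_eq_conjTranspose, add_sub_cancel, smul_smul]
  -- the shifted identity
  have hId' : WardD4Identity t t' U n hΛ h0 hz μ Λm' O' s B tt γ wv hsh Y u b cw wp Xp wm Xm ah dc V w a word
      (c - S) := by
    unfold WardD4Identity at hId ⊢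
    rw [hgram, Complex.ofReal_sub, sub_smul]
    have h2 := congrArg (fun X : FermionOp Λ' => X + ((S : ℝ) : ℂ) • (1 : FermionOp Λ')) hId
    convert h2 using 1 <;> abel
  have hfin := hS t t' U hU n hn0 hn2 Λ Λ' hΛ h8 h0 hz μ _ inferInstance inferInstance Λm' hPSD O' κ s B ι tt γ wv
    hsh Y ρ u b cw hcw θ wp Xp θ' wm Xm δ ah dc V κ'' w a word (c - S) hId'
  rw [hSdef] at hfin
  linarith

end Summit.Ventures.CertifiedManyBodySolver.Theorems.WardSlot
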